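import Summits.QuantumAdvantage.QuantumAdvantage.Theorems.SosSandwichTransferPBMachineDefs
import HarnessLib

/-!
# Crux `TransferPB` (stmt-QuantumAdvantage-15238, route SosSandwich), line `birth` — transcript congruence for the combined oracle `A ⊕ g`

Toolkit for the machine half of stub `stub_pbOracleSimulation`: the transcript machine of the stub runs with
the combined oracle `Oracle.ofLanguage {false :: v | v ∈ A} ∪ {true :: v | g v = true}`. This file proves
the two facts every argument about such runs uses — `run_eq_of_agree` (oracles agreeing on the transcript of a
run give the same run; Arora–Barak §3.4) and the answer table of the combined oracle
(`mem_combined_true_cons`, `mem_combined_false_cons`, `nil_not_mem_combined`, `combinedOracle_eq_of`: two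
combined oracles with the same `A` agree on a query unless it is `true :: v` with `g v ≠ g' v`). Used by the
refutation `Theorems/SosSandwichTransferPBMachineSplitNotForallG.lean` of the over-strong machine hypothesis
and available to the machine construction. All proved; folklore.
Source: S. Arora, B. Barak, Computational Complexity (CUP 2009), §3.4 (oracle machines: the run is a function
of the answers received).
-/

-- D-0017: single-conjunct summit ⇒ the duplicate `QuantumAdvantage.QuantumAdvantage` is mandated.
set_option linter.dupNamespace false

noncomputable section

namespace Summit.QuantumAdvantage.QuantumAdvantage.Cruxes.TransferPB.Birth

open Finset Literature.Computability.Cryptography Literature.Computability.Complexity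
  Literature.Computability.QuantumComplexity

namespace SimTreePB

/-! ### Transcript congruence -/

section Congr

variable {β : Type}

/-- **Agreeing oracles give equal runs**: if `O` and `O'` agree on every query of the run of `M` with `O`,
the two runs (from the same partial transcript, with the same fuel) coincide. [folklore] -/
theorem runAux_eq_of_agree (M : OracleAlg β) {O O' : Oracle} (x : List Bool) :
    ∀ (k : ℕ) (ans : List (List Bool)), (∀ q ∈ M.queriesAux O x k ans, O q = O' q) →
      M.runAux O x k ans = M.runAux O' x k ans
  | 0, _, _ => rfl
  | k + 1, ans, h => by
    rw [OracleAlg.runAux_succ, OracleAlg.runAux_succ]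
    cases hs : M.step x ans with
    | inl q =>
      have hmem : ∀ q', q' ∈ q :: M.queriesAux O x k (ans ++ [O q]) → q' ∈ M.queriesAux O x (k + 1) ans := by
        intro q' hq'
        unfold OracleAlg.queriesAux
        rw [hs]
        exact hq'
      have hq : O q = O' q := h q (hmem q List.mem_cons_self)
      simp only
      rw [← hq]
      exact runAux_eq_of_agree M x k (ans ++ [O q]) fun q' hq' => h q' (hmem q' (List.mem_cons_of_mem _ hq'))
    | inr b => rfl

/-- Runs of `M` with oracles agreeing on the transcript coincide. [folklore] -/
theorem run_eq_of_agree (M : OracleAlg β) {O O' : Oracle} {k : ℕ} {x : List Bool}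
    (h : ∀ q ∈ M.queries O k x, O q = O' q) : M.run O k x = M.run O' k x :=
  runAux_eq_of_agree M x k [] h

/-- Membership of a `true`-tagged query in the combined language is the answer of `g`. [folklore] -/
theorem mem_combined_true_cons (A : Set (List Bool)) (g : List Bool → Bool) (v : List Bool) :
    (true :: v) ∈ {w : List Bool | ∃ v : List Bool,
        (w = false :: v ∧ v ∈ A) ∨ (w = true :: v ∧ g v = true)} ↔ g v = true := by
  simp only [Set.mem_setOf_eq]
  constructor
  · rintro ⟨v', h | h⟩
    · exact absurd (List.cons_eq_cons.1 h.1).1 (by simp)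
    · rw [(List.cons_eq_cons.1 h.1).2]
      exact h.2
  · intro h
    exact ⟨v, Or.inr ⟨rfl, h⟩⟩

/-- Membership of a `false`-tagged query in the combined language is membership in `A`. [folklore] -/
theorem mem_combined_false_cons (A : Set (List Bool)) (g : List Bool → Bool) (v : List Bool) :
    (false :: v) ∈ {w : List Bool | ∃ v : List Bool,
        (w = false :: v ∧ v ∈ A) ∨ (w = true :: v ∧ g v = true)} ↔ v ∈ A := by
  simp only [Set.mem_setOf_eq]
  constructor
  · rintro ⟨v', h | h⟩
    · rw [(List.cons_eq_cons.1 h.1).2]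
      exact h.2
    · exact absurd (List.cons_eq_cons.1 h.1).1 (by simp)
  · intro h
    exact ⟨v, Or.inl ⟨rfl, h⟩⟩

/-- The empty query is not in the combined language. [folklore] -/
theorem nil_not_mem_combined (A : Set (List Bool)) (g : List Bool → Bool) :
    ([] : List Bool) ∉ {w : List Bool | ∃ v : List Bool,
        (w = false :: v ∧ v ∈ A) ∨ (w = true :: v ∧ g v = true)} := by
  simp only [Set.mem_setOf_eq, not_exists]
  rintro v (h | h) <;> exact absurd h.1 (by simp)

/-- Two combined oracles with the same `A` agree on a query unless it is `true :: v` with `g v ≠ g' v`.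
[folklore] -/
theorem combinedOracle_eq_of (A : Set (List Bool)) {g g' : List Bool → Bool} {w : List Bool}
    (h : ∀ v : List Bool, w = true :: v → g v = g' v) :
    Oracle.ofLanguage {w : List Bool | ∃ v : List Bool,
        (w = false :: v ∧ v ∈ A) ∨ (w = true :: v ∧ g v = true)} w =
      Oracle.ofLanguage {w : List Bool | ∃ v : List Bool,
        (w = false :: v ∧ v ∈ A) ∨ (w = true :: v ∧ g' v = true)} w := by
  rw [Oracle.ofLanguage_apply, Oracle.ofLanguage_apply]
  congr 1
  -- sets with the same membership of `w` have the same indicator bit at `w`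
  suffices hiff : w ∈ {w : List Bool | ∃ v : List Bool, (w = false :: v ∧ v ∈ A) ∨ (w = true :: v ∧ g v = true)} ↔
      w ∈ {w : List Bool | ∃ v : List Bool, (w = false :: v ∧ v ∈ A) ∨ (w = true :: v ∧ g' v = true)} by
    by_cases hw : w ∈ {w : List Bool | ∃ v : List Bool, (w = false :: v ∧ v ∈ A) ∨ (w = true :: v ∧ g v = true)}
    · rw [(Set.mem_iff_boolIndicator _ w).1 hw, (Set.mem_iff_boolIndicator _ w).1 (hiff.1 hw)]
    · rw [(Set.notMem_iff_boolIndicator _ w).1 hw, (Set.notMem_iff_boolIndicator _ w).1 (fun h' => hw (hiff.2 h'))]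
  rcases w with _ | ⟨b, v⟩
  · exact ⟨fun hm => absurd hm (nil_not_mem_combined A g), fun hm => absurd hm (nil_not_mem_combined A g')⟩
  · cases b
    · rw [mem_combined_false_cons, mem_combined_false_cons]
    · rw [mem_combined_true_cons, mem_combined_true_cons, h v rfl]

end Congr

end SimTreePB

end Summit.QuantumAdvantage.QuantumAdvantage.Cruxes.TransferPB.Birth

end
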